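import Literature.MathematicalPhysics.QuantumFieldTheory.Balaban1983to89.BlockAveragingEMLLinearised
import Literature.MathematicalPhysics.QuantumFieldTheory.Balaban1983to89.B12SmallFieldDomain259
import Literature.MathematicalPhysics.QuantumFieldTheory.Balaban1983to89.T4ReflectionConeSharp

/-!
# [Balaban1987RG1] p. 267: the distinguished bond `b₀(c)` INSIDE the (0.4) loops at `c` — on-axis ∕ off-axis loops, the
# straight-line transporters split at `b₀(c)`, foreign `b₀(c′)` never on a loop at `c` (torus bookkeeping for the NONLINEAR rider)

Cell `pub-ymgap` (YM-PLAN Track A), seat `pub-ymgap-dag-n09-w4` g3, GEOMETRY half of the nonlinear form of the p. 266–267 rider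
«The above restrictions imply also restrictions on B′(b₀(c)), with the constant ε₁ replaced by O(ε₁)» (consumer:
`B12B0RestrictionNonlinear267`).  Helper toward K1⁷ (stmt-QuantumFields-20542), count-neutral.

WHAT IS HERE (kernel bookkeeping over the tree's objects — `BlockAveraging.loopHol` ∕ `avgFun` of [I] (0.4), lit-balaban r09's
`B12SmallFieldDomain259.b0` = print's `b₀(c)` p. 267, `B10Eq47AxialChi.rowProd` ∕ `shiftN`; 0 `def`, 0 `sorry`):
* (both end points of a traversed bond are prefix ends: the tree's `T4ReflectionConeSharp.exists_tgt_eq_walkEnd_take`);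
* §2 the staircases `Γ^σ_{y→x}` of (0.3) stay inside the block `B(y)` bondwise (`stair_src_tgt_blockOf`), hence never traverse any
  distinguished bond `b₀(c′)` (`stair_bond_ne_b0` — `b₀(c′)` joins two different blocks, r09 `blockOf_b0_src ∕ _tgt`);
* §3 the straight line `[x, x′]` from `x = blockSite c₋ r`: its bonds are `⟨x + te_μ, μ⟩`, `t < L` (`mem_walk_replicate_true`); such a bond
  is a distinguished bond `b₀(c′)` only if `c′ = c` (`eq_of_line_bond_eq_b0`), and then `x` is ON THE AXIS of `c` (`r_ν = (L−1)/2` for `ν ≠ μ`)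
  and `t = L − 1 − r_μ` (`onAxis_of_line_bond_eq_b0`); conversely (`line_bond_eq_b0_of_onAxis`);
* §4 straight products split at a bond (`rowProd_add`, `rowProd_update_line`, `rowProd_eq_split`);
* §5 the ON-AXIS PATH IDENTITY: for `x` on the axis, `U(Γ^σ_{y→x})·U([x, b₀(c)₋]) = U([emb y, b₀(c)₋])` whatever the ordering `σ`
  and whichever side of `y` the point `x` lies (back-and-forth steps cancel; `holAt_stair_mul_rowProd_of_onAxis`).

HONEST FRAMING: lattice-walk combinatorics on the tree's torus; NOTHING of Bałaban's estimates is asserted; no summit statement is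
touched; one finite four-torus programme downstream — not continuum ∕ ℝ⁴ ∕ OS ∕ mass gap ∕ Clay.
-/

namespace Literature.MathematicalPhysics.QuantumFieldTheory.Balaban1983to89

namespace B12B0LoopGeometry267

open T4Continuum BlockAveraging AveragingRT B10Eq47AxialChi
open B12SmallFieldDomain259 (b0 blockOf_b0_src blockOf_b0_tgt src_ne_tgt)

variable {P : Params} {j : ℕ}

/-! ## §2 Staircases stay inside their block -/

/-- Every prefix of the staircase `Γ^σ_{y→x}` ends in `B(y)` (standing range). [cite: Balaban1987RG1, (0.3) p.252] -/
theorem blockOf_walkEnd_take_stairWord (hj : j + 1 ≤ P.m + P.K) (y : Site P (j + 1)) (σ : Equiv.Perm (Fin P.d))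
    (r : Fin P.d → Fin P.L) (k : ℕ) : blockOf (walkEnd (emb y) ((stairWord σ (off r)).take k)) = y := by
  refine blockOf_eq_of_near_emb hj y _ (fun κ => netDisp ((stairWord σ (off r)).take k) κ) (fun ν => walkEnd_apply _ _ ν) ?_
  intro ν
  have h1 := netDisp_take_stairWord σ (off r) ν k
  have h2 := off_bounds r ν
  constructor
  · exact le_trans (le_min (by omega) h2.1) h1.1
  · exact le_trans h1.2 (max_le (by omega) h2.2)

/-- **Staircase bonds have both end points in `B(y)`.** [cite: Balaban1987RG1, (0.3) p.252] -/
theorem stair_src_tgt_blockOf (hj : j + 1 ≤ P.m + P.K) (y : Site P (j + 1)) (σ : Equiv.Perm (Fin P.d))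
    (r : Fin P.d → Fin P.L) (s : LStep P j) (hs : s ∈ walk (emb y) (stairWord σ (off r))) :
    blockOf s.bond.src = y ∧ blockOf s.bond.tgt = y := by
  obtain ⟨k, hk⟩ := exists_src_eq_walkEnd_take _ _ s hs
  obtain ⟨k', hk'⟩ := T4ReflectionConeSharp.exists_tgt_eq_walkEnd_take _ _ s hs
  exact ⟨by rw [hk, blockOf_walkEnd_take_stairWord hj], by rw [hk', blockOf_walkEnd_take_stairWord hj]⟩

/-- **No staircase traverses a distinguished bond `b₀(c′)`** (`b₀(c′)` runs from `B(c′₋)` to `B(c′₊) ≠ B(c′₋)`).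
[cite: Balaban1987RG1, p.267] -/
theorem stair_bond_ne_b0 (hj : j + 1 ≤ P.m + P.K) (y : Site P (j + 1)) (σ : Equiv.Perm (Fin P.d))
    (r : Fin P.d → Fin P.L) (c' : PBond P (j + 1)) (s : LStep P j) (hs : s ∈ walk (emb y) (stairWord σ (off r))) :
    s.bond ≠ b0 c' := by
  intro h
  obtain ⟨h1, h2⟩ := stair_src_tgt_blockOf hj y σ r s hs
  rw [h, blockOf_b0_src hj, blockOf_b0_tgt hj] at *
  exact src_ne_tgt c' (h1.trans h2.symm)

/-! ## §3 The straight line `[x, x′]` from a block site and the distinguished bond -/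

/-- The straight walk of `m+1` steps is the walk of `m` steps followed by the bond `⟨x + me_μ, μ⟩`. [cite: Balaban1985Averaging, (9) p.19] -/
theorem walk_replicate_true_succ (x : Site P j) (μ : Fin P.d) (m : ℕ) :
    walk x (List.replicate (m + 1) (μ, true)) = walk x (List.replicate m (μ, true)) ++ [⟨⟨shiftN x μ m, μ⟩, true⟩] := by
  rw [List.replicate_succ', walk_append, BlockAveragingEMLProp2.walkEnd_replicate_true]
  rfl

/-- **THE BONDS OF THE STRAIGHT WALK**: `s ∈ walk x (m steps +e_μ) ↔ s = ⟨⟨x + te_μ, μ⟩, +⟩` for some `t < m`. [cite: Balaban1985Averaging, (9) p.19] -/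
theorem mem_walk_replicate_true (x : Site P j) (μ : Fin P.d) :
    ∀ (m : ℕ) (s : LStep P j), s ∈ walk x (List.replicate m (μ, true)) ↔ ∃ t < m, s = ⟨⟨shiftN x μ t, μ⟩, true⟩
  | 0, s => by simp [walk]
  | m + 1, s => by
    rw [walk_replicate_true_succ, List.mem_append, List.mem_singleton, mem_walk_replicate_true x μ m s]
    constructor
    · rintro (⟨t, ht, rfl⟩ | rfl)
      · exact ⟨t, Nat.lt_succ_of_lt ht, rfl⟩
      · exact ⟨m, Nat.lt_succ_self m, rfl⟩
    · rintro ⟨t, ht, rfl⟩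
      rcases Nat.lt_succ_iff_lt_or_eq.1 ht with ht | rfl
      · exact Or.inl ⟨t, ht, rfl⟩
      · exact Or.inr rfl

/-- `x + te_μ` for `x = blockSite y r` with `r_μ + t ≤ L − 1` is the block site of `B(y)` with offset `r + te_μ`. [cite: Balaban1987RG1, (0.1) p.252] -/
theorem shiftN_blockSite_eq_of_le (hj : j + 1 ≤ P.m + P.K) (y : Site P (j + 1)) (r : Fin P.d → Fin P.L) (μ : Fin P.d) (t : ℕ)
    (ht : (r μ : ℕ) + t ≤ P.L - 1) :
    shiftN (Site.blockSite y r) μ t =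
      Site.blockSite y (Function.update r μ ⟨r μ + t, by have := P.hL.2; omega⟩) := by
  have _ := hj
  funext κ
  rw [BlockAveragingEMLProp2.shiftN_apply]
  by_cases hκ : κ = μ
  · subst hκ
    simp only [if_true, Site.blockSite, Function.update_self]
    push_cast; ring
  · simp only [if_neg hκ, add_zero, Site.blockSite, Function.update_of_ne hκ]

/-- `x + te_μ` for `x = blockSite c₋ r` with `L ≤ r_μ + t ≤ 2L − 1` is the block site of `B(c₊)` with offset `r + (t − L)e_μ` (standing range).
[cite: Balaban1987RG1, (0.1) p.252] -/
theorem shiftN_blockSite_eq_of_ge (hj : j + 1 ≤ P.m + P.K) (c : PBond P (j + 1)) (r : Fin P.d → Fin P.L) (t : ℕ)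
    (h1 : P.L ≤ (r c.dir : ℕ) + t) (h2 : (r c.dir : ℕ) + t ≤ 2 * P.L - 1) :
    shiftN (Site.blockSite c.src r) c.dir t =
      Site.blockSite c.tgt (Function.update r c.dir ⟨r c.dir + t - P.L, by have := P.hL.2; omega⟩) := by
  funext κ
  rw [BlockAveragingEMLProp2.shiftN_apply]
  by_cases hκ : κ = c.dir
  · subst hκ
    simp only [if_true, Site.blockSite, Function.update_self, PBond.tgt, Site.shift]
    rw [cast_succ_mul_L hj]
    have e : (c.src c.dir).val * P.L + P.L + ((r c.dir : ℕ) + t - P.L) = (c.src c.dir).val * P.L + r c.dir + t := by omega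
    rw [e]; push_cast; ring
  · have htgt : c.tgt κ = c.src κ := by simp [PBond.tgt, Site.shift, Function.update_of_ne hκ]
    simp only [if_neg hκ, add_zero, Site.blockSite, Function.update_of_ne hκ, htgt]

/-- Hence the block of `x + te_μ` (`x = blockSite c₋ r`): `B(c₋)` while `r_μ + t ≤ L − 1`. [cite: Balaban1987RG1, (0.1) p.252] -/
theorem blockOf_shiftN_blockSite_of_le (hj : j + 1 ≤ P.m + P.K) (c : PBond P (j + 1)) (r : Fin P.d → Fin P.L) (t : ℕ)
    (ht : (r c.dir : ℕ) + t ≤ P.L - 1) : blockOf (shiftN (Site.blockSite c.src r) c.dir t) = c.src := by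
  rw [shiftN_blockSite_eq_of_le hj c.src r c.dir t ht, Site.blockOf_blockSite hj]

/-- … and `B(c₊)` once `r_μ + t ≥ L` (`t ≤ L`). [cite: Balaban1987RG1, (0.1) p.252] -/
theorem blockOf_shiftN_blockSite_of_ge (hj : j + 1 ≤ P.m + P.K) (c : PBond P (j + 1)) (r : Fin P.d → Fin P.L) (t : ℕ)
    (h1 : P.L ≤ (r c.dir : ℕ) + t) (h2 : t ≤ P.L) : blockOf (shiftN (Site.blockSite c.src r) c.dir t) = c.tgt := by
  have := (r c.dir).isLt
  rw [shiftN_blockSite_eq_of_ge hj c r t h1 (by omega), Site.blockOf_blockSite hj]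

/-- **A BOND OF THE LINE `[x, x′]` (`x = blockSite c₋ r`, `t < L`) WHICH IS A DISTINGUISHED BOND `b₀(c′)` HAS `c′ = c`** — the separation of
print's distinguished bonds seen from the loops at `c`. [cite: Balaban1987RG1, p.267] -/
theorem eq_of_line_bond_eq_b0 (hj : j + 1 ≤ P.m + P.K) (c : PBond P (j + 1)) (r : Fin P.d → Fin P.L) {t : ℕ} (ht : t < P.L)
    (c' : PBond P (j + 1)) (h : (⟨shiftN (Site.blockSite c.src r) c.dir t, c.dir⟩ : PBond P j) = b0 c') : c' = c := by
  have hsrc := blockOf_b0_src hj c'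
  have htgt := blockOf_b0_tgt hj c'
  have hdir : c'.dir = c.dir := by
    have := congrArg PBond.dir h; exact (B12SmallFieldDomain259.b0_dir c').symm.trans this.symm
  rw [← h] at hsrc htgt
  change blockOf (shiftN (Site.blockSite c.src r) c.dir t) = c'.src at hsrc
  change blockOf ((shiftN (Site.blockSite c.src r) c.dir t).shift c.dir) = c'.tgt at htgt
  rw [← shiftN_succ] at htgt
  have hL := P.hL.2
  have hrlt := (r c.dir).isLt
  by_cases hlo : (r c.dir : ℕ) + (t + 1) ≤ P.L - 1
  · -- both ends in `B(c₋)`: impossible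
    rw [blockOf_shiftN_blockSite_of_le hj c r t (by omega)] at hsrc
    rw [blockOf_shiftN_blockSite_of_le hj c r (t + 1) hlo] at htgt
    exact absurd (hsrc.symm.trans htgt) (src_ne_tgt c')
  · by_cases hmid : (r c.dir : ℕ) + t ≤ P.L - 1
    · -- the crossing bond: `c′₋ = c₋`, same direction
      rw [blockOf_shiftN_blockSite_of_le hj c r t hmid] at hsrc
      cases c; cases c'
      simp only [PBond.mk.injEq]
      exact ⟨hsrc.symm, hdir⟩
    · -- both ends in `B(c₊)`: impossible
      rw [blockOf_shiftN_blockSite_of_ge hj c r t (by omega) ht.le] at hsrc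
      rw [blockOf_shiftN_blockSite_of_ge hj c r (t + 1) (by omega) (by omega)] at htgt
      exact absurd (hsrc.symm.trans htgt) (src_ne_tgt c')

/-- `b₀(c)` as a line bond from the block centre: `b₀(c) = ⟨emb c₋ + ((L−1)/2)e_μ, μ⟩`. [cite: Balaban1987RG1, p.267] -/
theorem b0_eq_shiftN_emb (c : PBond P (j + 1)) :
    b0 c = ⟨shiftN (emb c.src) c.dir ((P.L - 1) / 2), c.dir⟩ := by
  rw [B12SmallFieldDomain259.b0_eq_line, AveragingRT.line]
  congr 1
  rw [← walkEnd_replicate_line, BlockAveragingEMLProp2.walkEnd_replicate_true]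

/-- The block centre is the block site with all offsets `(L−1)/2`. [cite: Balaban1987RG1, (0.1) p.252] -/
theorem emb_eq_blockSite (y : Site P (j + 1)) :
    emb y = Site.blockSite y (fun _ => ⟨(P.L - 1) / 2, half_lt P⟩) := by
  funext κ; rfl

/-- **IF THE LINE FROM `x = blockSite c₋ r` TRAVERSES `b₀(c)` AT STEP `t`, THEN `x` IS ON THE AXIS OF `c` AND `t = L − 1 − r_μ`.**
[cite: Balaban1987RG1, p.267] -/
theorem onAxis_of_line_bond_eq_b0 (hj : j + 1 ≤ P.m + P.K) (c : PBond P (j + 1)) (r : Fin P.d → Fin P.L) {t : ℕ} (ht : t < P.L)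
    (h : (⟨shiftN (Site.blockSite c.src r) c.dir t, c.dir⟩ : PBond P j) = b0 c) :
    (∀ ν, ν ≠ c.dir → (r ν : ℕ) = (P.L - 1) / 2) ∧ t = P.L - 1 - r c.dir := by
  have hsite : shiftN (Site.blockSite c.src r) c.dir t = shiftN (emb c.src) c.dir ((P.L - 1) / 2) := by
    have := congrArg PBond.src h; rwa [b0_eq_shiftN_emb] at this
  have hL := P.hL.2
  obtain ⟨k, hk⟩ := P.hL.1
  have hrlt := (r c.dir).isLt
  by_cases hmid : (r c.dir : ℕ) + t ≤ P.L - 1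
  · rw [shiftN_blockSite_eq_of_le hj c.src r c.dir t hmid, emb_eq_blockSite,
      shiftN_blockSite_eq_of_le hj c.src _ c.dir _ (by simp; omega)] at hsite
    have hr := (blockSite_inj hj hsite).2
    constructor
    · intro ν hν
      have := congrFun hr ν
      rw [Function.update_of_ne hν, Function.update_of_ne hν] at this
      exact congrArg Fin.val this
    · have := congrArg Fin.val (congrFun hr c.dir)
      simp only [Function.update_self, Fin.val_mk] at this
      omega
  · exfalso
    have h1 : blockOf (shiftN (Site.blockSite c.src r) c.dir t) = c.tgt := blockOf_shiftN_blockSite_of_ge hj c r t (by omega) ht.le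
    have h2 : blockOf (shiftN (emb c.src) c.dir ((P.L - 1) / 2)) = c.src := by
      rw [emb_eq_blockSite, blockOf_shiftN_blockSite_of_le hj c _ _ (by simp; omega)]
    rw [hsite, h2] at h1
    exact src_ne_tgt c h1

/-- Conversely, ON THE AXIS the line from `x = blockSite c₋ r` traverses `b₀(c)` at step `L − 1 − r_μ`. [cite: Balaban1987RG1, p.267] -/
theorem line_bond_eq_b0_of_onAxis (hj : j + 1 ≤ P.m + P.K) (c : PBond P (j + 1)) (r : Fin P.d → Fin P.L)
    (hon : ∀ ν, ν ≠ c.dir → (r ν : ℕ) = (P.L - 1) / 2) :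
    (⟨shiftN (Site.blockSite c.src r) c.dir (P.L - 1 - r c.dir), c.dir⟩ : PBond P j) = b0 c := by
  have hrlt := (r c.dir).isLt
  rw [b0_eq_shiftN_emb, shiftN_blockSite_eq_of_le hj c.src r c.dir _ (by omega), emb_eq_blockSite,
    shiftN_blockSite_eq_of_le hj c.src _ c.dir _ (by simp; have := P.hL.2; omega)]
  congr 2
  funext ν
  by_cases hν : ν = c.dir
  · subst hν; simp only [Function.update_self]; apply Fin.ext; simp
    have := P.hL.2; obtain ⟨k, hk⟩ := P.hL.1; omega
  · rw [Function.update_of_ne hν, Function.update_of_ne hν]; exact Fin.ext (hon ν hν)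

/-- The line sites `x + te_μ`, `t < L`, from `x = blockSite c₋ r` are pairwise distinct (standing range). [cite: Balaban1985Averaging, (9) p.19] -/
theorem shiftN_blockSite_injOn (hj : j + 1 ≤ P.m + P.K) (c : PBond P (j + 1)) (r : Fin P.d → Fin P.L) {t t' : ℕ}
    (ht : t < P.L) (ht' : t' < P.L) (h : shiftN (Site.blockSite c.src r) c.dir t = shiftN (Site.blockSite c.src r) c.dir t') :
    t = t' := by
  have hL := P.hL.2
  have hrlt := (r c.dir).isLt
  by_cases h1 : (r c.dir : ℕ) + t ≤ P.L - 1 <;> by_cases h2 : (r c.dir : ℕ) + t' ≤ P.L - 1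
  · rw [shiftN_blockSite_eq_of_le hj c.src r c.dir t h1, shiftN_blockSite_eq_of_le hj c.src r c.dir t' h2] at h
    have := congrArg Fin.val (congrFun (blockSite_inj hj h).2 c.dir)
    simp only [Function.update_self, Fin.val_mk] at this
    omega
  · exfalso
    have e1 := blockOf_shiftN_blockSite_of_le hj c r t h1
    have e2 := blockOf_shiftN_blockSite_of_ge hj c r t' (by omega) ht'.le
    rw [h, e2] at e1
    exact src_ne_tgt c e1.symm
  · exfalso
    have e1 := blockOf_shiftN_blockSite_of_ge hj c r t (by omega) ht.le
    have e2 := blockOf_shiftN_blockSite_of_le hj c r t' h2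
    rw [h, e2] at e1
    exact src_ne_tgt c e1
  · rw [shiftN_blockSite_eq_of_ge hj c r t (by omega) (by omega), shiftN_blockSite_eq_of_ge hj c r t' (by omega) (by omega)] at h
    have := congrArg Fin.val (congrFun (blockSite_inj hj h).2 c.dir)
    simp only [Function.update_self, Fin.val_mk] at this
    omega

/-! ## §4 Straight products split at a bond -/

/-- `x + (a+b)e_μ = (x + ae_μ) + be_μ` (also in a Summits-side file; private here). [folklore] -/
private theorem shiftN_add (x : Site P j) (μ : Fin P.d) (a : ℕ) : ∀ b : ℕ, shiftN x μ (a + b) = shiftN (shiftN x μ a) μ b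
  | 0 => rfl
  | b + 1 => by rw [← Nat.add_assoc, shiftN_succ, shiftN_add x μ a b, shiftN_succ]

variable {G : Type*} [GaugeGroup G]

/-- `U([x, x+(a+b)e_μ]) = U([x, x+ae_μ])·U([x+ae_μ, x+(a+b)e_μ])` (transports along a straight contour multiply; also in a Summits-side file,
private here). [folklore] -/
private theorem rowProd_add (U : GaugeField P j G) (x : Site P j) (μ : Fin P.d) (a : ℕ) :
    ∀ b : ℕ, rowProd U x μ (a + b) = rowProd U x μ a * rowProd U (shiftN x μ a) μ b
  | 0 => by simp
  | b + 1 => by rw [← Nat.add_assoc, rowProd_succ, rowProd_add U x μ a b, rowProd_succ, shiftN_add, mul_assoc]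

/-- A straight product depends only on the variables of its own bonds. [cite: Balaban1985Averaging, (9) p.19] -/
theorem rowProd_congr {U V : GaugeField P j G} (x : Site P j) (μ : Fin P.d) :
    ∀ m : ℕ, (∀ t < m, U ⟨shiftN x μ t, μ⟩ = V ⟨shiftN x μ t, μ⟩) → rowProd U x μ m = rowProd V x μ m
  | 0, _ => rfl
  | m + 1, h => by
    rw [rowProd_succ, rowProd_succ, rowProd_congr x μ m fun t ht => h t (Nat.lt_succ_of_lt ht), h m (Nat.lt_succ_self m)]

/-- **A STRAIGHT PRODUCT SPLIT AT ITS `t`-TH BOND**: `U([x, x+me_μ]) = U([x, x+te_μ])·U(x+te_μ, x+(t+1)e_μ)·U([x+(t+1)e_μ, x+me_μ])`.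
[cite: Balaban1985Averaging, (9) p.19] -/
theorem rowProd_eq_split (U : GaugeField P j G) (x : Site P j) (μ : Fin P.d) {t m : ℕ} (htm : t < m) :
    rowProd U x μ m = rowProd U x μ t * U ⟨shiftN x μ t, μ⟩ * rowProd U (shiftN x μ (t + 1)) μ (m - t - 1) := by
  obtain ⟨k, rfl⟩ := Nat.exists_eq_add_of_lt htm
  rw [show t + k + 1 = t + (1 + k) by ring, rowProd_add, rowProd_add, show t + (1 + k) - t - 1 = k by omega]
  simp [rowProd_succ, shiftN_succ, mul_assoc]

/-- **THE LINE FROM `x = blockSite c₋ r` WITH ONE VARIABLE REPLACED**: if the bond `⟨x + t⋆e_μ, μ⟩` (`t⋆ < L`) carries `g` instead of its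
variable, `U([x,x′])` becomes `U([x, x+t⋆e_μ])·g·U([x+(t⋆+1)e_μ, x′])` (the other line bonds are distinct from it, `shiftN_blockSite_injOn`).
[cite: Balaban1987RG1, p.267] -/
theorem rowProd_update_line [DecidableEq (PBond P j)] (hj : j + 1 ≤ P.m + P.K) (c : PBond P (j + 1)) (r : Fin P.d → Fin P.L)
    (U : GaugeField P j G) (g : G) {t : ℕ} (ht : t < P.L) :
    rowProd (Function.update U ⟨shiftN (Site.blockSite c.src r) c.dir t, c.dir⟩ g) (Site.blockSite c.src r) c.dir P.L =
      rowProd U (Site.blockSite c.src r) c.dir t * g * rowProd U (shiftN (Site.blockSite c.src r) c.dir (t + 1)) c.dir (P.L - t - 1) := by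
  set x := Site.blockSite c.src r with hx
  rw [rowProd_eq_split _ x c.dir ht, Function.update_self]
  congr 1
  · congr 1
    refine rowProd_congr x c.dir t fun t' ht' => Function.update_of_ne ?_ _ _
    intro h
    have := shiftN_blockSite_injOn hj c r (ht'.trans ht) ht (congrArg PBond.src h)
    omega
  · refine rowProd_congr _ c.dir _ fun t' ht' => Function.update_of_ne ?_ _ _
    intro h
    have h' := congrArg PBond.src h
    simp only at h'
    rw [← shiftN_add] at h'
    have := shiftN_blockSite_injOn hj c r (by omega) ht h'
    omega

/-- A straight product from `x = blockSite c₋ r` is unchanged by replacing the variable of a bond which is NOT on the line.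
[cite: Balaban1987RG1, p.267] -/
theorem rowProd_update_of_forall_ne [DecidableEq (PBond P j)] (U : GaugeField P j G) (x : Site P j) (μ : Fin P.d) (m : ℕ)
    (b : PBond P j) (g : G) (h : ∀ t < m, (⟨shiftN x μ t, μ⟩ : PBond P j) ≠ b) :
    rowProd (Function.update U b g) x μ m = rowProd U x μ m :=
  rowProd_congr x μ m fun t ht => Function.update_of_ne (h t ht) _ _

/-! ## §5 The on-axis path identity -/

/-- A staircase all of whose runs but the `μ`-run are empty is the `μ`-run. [cite: Balaban1987RG1, (0.3) p.252] -/
theorem stairRuns_eq_of_forall_eq_zero {d : ℕ} (n : Fin d → ℤ) (μ : Fin d) (hn : ∀ a, a ≠ μ → n a = 0) :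
    ∀ as : List (Fin d), as.Nodup → stairRuns n as = if μ ∈ as then axisRun μ (n μ) else []
  | [], _ => by simp [stairRuns]
  | a :: as, hnd => by
    rw [List.nodup_cons] at hnd
    rw [stairRuns, stairRuns_eq_of_forall_eq_zero n μ hn as hnd.2]
    by_cases ha : a = μ
    · subst ha
      simp [hnd.1]
    · have h0 : axisRun a (n a) = [] := by rw [hn a ha]; simp [axisRun]
      rw [h0, List.nil_append]
      simp [Ne.symm ha]

/-- ON THE AXIS the staircase word is the `μ`-run: `Γ^σ_{y→x} = axisRun μ n_μ` for every ordering `σ`. [cite: Balaban1987RG1, (0.3) p.252] -/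
theorem stairWord_eq_axisRun {d : ℕ} (σ : Equiv.Perm (Fin d)) (n : Fin d → ℤ) (μ : Fin d) (hn : ∀ a, a ≠ μ → n a = 0) :
    stairWord σ n = axisRun μ (n μ) := by
  rw [stairWord, stairRuns_eq_of_forall_eq_zero n μ hn _ (nodup_finRange_map σ), if_pos (mem_finRange_map σ μ)]

/-- The straight walk along a run of `+μ` letters has holonomy the straight product. [cite: Balaban1985Averaging, (9) p.19] -/
theorem holAt_walk_replicate_true' (U : GaugeField P j G) (x : Site P j) (μ : Fin P.d) (m : ℕ) :
    holAt U (walk x (List.replicate m (μ, true))) = rowProd U x μ m :=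
  BlockAveragingEMLProp2.holAt_walk_replicate_true U x μ m

/-- Walking back `m` steps `−μ` and then `m` steps `+μ` returns to the start. [cite: Balaban1987RG1, (0.3) p.252 (bookkeeping)] -/
theorem walkEnd_replicate_false_true (x : Site P j) (μ : Fin P.d) (m : ℕ) :
    walkEnd (walkEnd x (List.replicate m (μ, false))) (List.replicate m (μ, true)) = x := by
  have h : List.replicate m (μ, true) = wordRev (List.replicate m (μ, false)) := by rw [wordRev_replicate]; rfl
  rw [h, walkEnd_walkEnd_wordRev]

/-- The holonomy of `m` steps `−μ` from `x` is the inverse of the straight product from the end point. [cite: Balaban1985Averaging, (9) p.19] -/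
theorem holAt_walk_replicate_false (U : GaugeField P j G) (x : Site P j) (μ : Fin P.d) (m : ℕ) :
    holAt U (walk x (List.replicate m (μ, false))) = (rowProd U (walkEnd x (List.replicate m (μ, false))) μ m)⁻¹ := by
  have h : List.replicate m (μ, false) = wordRev (List.replicate m (μ, true)) := by rw [wordRev_replicate]; rfl
  set y := walkEnd x (List.replicate m (μ, false)) with hy
  have hx : x = walkEnd y (List.replicate m (μ, true)) := (walkEnd_replicate_false_true x μ m).symm
  conv_lhs => rw [hx, h]
  rw [holAt_walk_wordRev, holAt_walk_replicate_true']

/-- **THE ON-AXIS PATH IDENTITY**: for `x = blockSite c₋ r` ON THE AXIS of `c` (`r_ν = (L−1)/2`, `ν ≠ μ`),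
`U(Γ^σ_{y→x})·U([x, x + (L−1−r_μ)e_μ]) = U([emb y, emb y + ((L−1)/2)e_μ])` — the transport from the block centre to `b₀(c)₋` along the axis,
whatever the ordering `σ` and on whichever side of the centre `x` lies (back-and-forth steps cancel). [cite: Balaban1987RG1, (0.3)–(0.4) pp.252–253] -/
theorem holAt_stair_mul_rowProd_of_onAxis (hj : j + 1 ≤ P.m + P.K) (U : GaugeField P j G) (c : PBond P (j + 1))
    (σ : Equiv.Perm (Fin P.d)) (r : Fin P.d → Fin P.L) (hon : ∀ ν, ν ≠ c.dir → (r ν : ℕ) = (P.L - 1) / 2) :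
    holAt U (walk (emb c.src) (stairWord σ (off r))) * rowProd U (Site.blockSite c.src r) c.dir (P.L - 1 - r c.dir) =
      rowProd U (emb c.src) c.dir ((P.L - 1) / 2) := by
  have _ := hj
  have hL := P.hL.2
  obtain ⟨kk, hkk⟩ := P.hL.1
  have hrlt := (r c.dir).isLt
  have hn : ∀ a, a ≠ c.dir → off r a = 0 := fun a ha => by simp only [off, hon a ha]; omega
  have hx : Site.blockSite c.src r = walkEnd (emb c.src) (stairWord σ (off r)) :=
    (BlockAveragingEMLLinearised.walkEnd_emb_stairWord_eq_blockSite c.src σ r).symm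
  rw [hx, stairWord_eq_axisRun σ (off r) c.dir hn, axisRun]
  by_cases hsgn : 0 ≤ off r c.dir
  · -- `x` ahead of the centre: both pieces run forward
    obtain ⟨k, hk⟩ := Int.eq_ofNat_of_zero_le hsgn
    have hk' : (r c.dir : ℕ) = (P.L - 1) / 2 + k := by simp only [off] at hk; omega
    have hdec : decide ((0 : ℤ) ≤ (k : ℤ)) = true := decide_eq_true (Int.natCast_nonneg k)
    rw [hk, hdec, Int.natAbs_natCast, holAt_walk_replicate_true', BlockAveragingEMLProp2.walkEnd_replicate_true, ← rowProd_add]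
    congr 1; omega
  · -- `x` behind the centre: `m` steps back, then `m + (L−1)/2` forward
    rw [not_le] at hsgn
    set m := (off r c.dir).natAbs with hm
    have hmz : (m : ℤ) = -off r c.dir := Int.ofNat_natAbs_of_nonpos hsgn.le
    have hm' : (r c.dir : ℕ) + m = (P.L - 1) / 2 := by simp only [off] at hmz; omega
    rw [decide_eq_false (not_le.mpr hsgn)]
    rw [holAt_walk_replicate_false, show P.L - 1 - (r c.dir : ℕ) = m + (P.L - 1) / 2 by omega, rowProd_add,
      ← mul_assoc, inv_mul_cancel, one_mul, ← BlockAveragingEMLProp2.walkEnd_replicate_true, walkEnd_replicate_false_true]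

/-! ## §6 The four segments of a (0.4) loop at `c` with ONE variable replaced at a distinguished bond -/

/-- **STAIRCASES ARE BLIND TO EVERY `b₀(c′)`**: replacing the variable at any `b₀(c′)` does not change `U(Γ^σ_{y→x})`.
[cite: Balaban1987RG1, p.267] -/
theorem holAt_stair_update_b0 [DecidableEq (PBond P j)] (hj : j + 1 ≤ P.m + P.K) (U : GaugeField P j G) (y : Site P (j + 1))
    (σ : Equiv.Perm (Fin P.d)) (r : Fin P.d → Fin P.L) (c' : PBond P (j + 1)) (g : G) :
    holAt (Function.update U (b0 c') g) (walk (emb y) (stairWord σ (off r))) = holAt U (walk (emb y) (stairWord σ (off r))) :=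
  T4ReflectionCone.holAt_congr fun s hs => Function.update_of_ne (stair_bond_ne_b0 hj y σ r c' s hs) _ _

/-- **THE LINE `[x,x′]` IS BLIND TO FOREIGN `b₀(c′)`, `c′ ≠ c`.** [cite: Balaban1987RG1, p.267] -/
theorem rowProd_line_update_b0_of_ne [DecidableEq (PBond P j)] (hj : j + 1 ≤ P.m + P.K) (U : GaugeField P j G) (c c' : PBond P (j + 1))
    (hc' : c' ≠ c) (r : Fin P.d → Fin P.L) (g : G) :
    rowProd (Function.update U (b0 c') g) (Site.blockSite c.src r) c.dir P.L = rowProd U (Site.blockSite c.src r) c.dir P.L :=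
  rowProd_update_of_forall_ne U _ c.dir P.L (b0 c') g fun _ ht h => hc' (eq_of_line_bond_eq_b0 hj c r ht c' h)

/-- **OFF THE AXIS THE LINE IS BLIND TO `b₀(c)` ITSELF.** [cite: Balaban1987RG1, p.267] -/
theorem rowProd_line_update_b0_of_offAxis [DecidableEq (PBond P j)] (hj : j + 1 ≤ P.m + P.K) (U : GaugeField P j G) (c : PBond P (j + 1))
    (r : Fin P.d → Fin P.L) (hoff : ¬ ∀ ν, ν ≠ c.dir → (r ν : ℕ) = (P.L - 1) / 2) (g : G) :
    rowProd (Function.update U (b0 c) g) (Site.blockSite c.src r) c.dir P.L = rowProd U (Site.blockSite c.src r) c.dir P.L :=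
  rowProd_update_of_forall_ne U _ c.dir P.L (b0 c) g fun _ ht h => hoff (onAxis_of_line_bond_eq_b0 hj c r ht h).1

/-- **ON THE AXIS THE LINE SPLITS AT `b₀(c)`**: `U([x,x′]) = U([x, b₀₋])·U(b₀(c))·U([b₀₊, x′])`, and with the variable at `b₀(c)` replaced by `g`
the middle factor becomes `g`. [cite: Balaban1987RG1, p.267] -/
theorem rowProd_line_split_of_onAxis [DecidableEq (PBond P j)] (hj : j + 1 ≤ P.m + P.K) (U : GaugeField P j G) (c : PBond P (j + 1))
    (r : Fin P.d → Fin P.L) (hon : ∀ ν, ν ≠ c.dir → (r ν : ℕ) = (P.L - 1) / 2) (g : G) :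
    rowProd U (Site.blockSite c.src r) c.dir P.L =
        rowProd U (Site.blockSite c.src r) c.dir (P.L - 1 - r c.dir) * U (b0 c) *
          rowProd U (shiftN (Site.blockSite c.src r) c.dir (P.L - 1 - r c.dir + 1)) c.dir (r c.dir) ∧
      rowProd (Function.update U (b0 c) g) (Site.blockSite c.src r) c.dir P.L =
        rowProd U (Site.blockSite c.src r) c.dir (P.L - 1 - r c.dir) * g *
          rowProd U (shiftN (Site.blockSite c.src r) c.dir (P.L - 1 - r c.dir + 1)) c.dir (r c.dir) := by
  have hrlt := (r c.dir).isLt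
  have ht : P.L - 1 - (r c.dir : ℕ) < P.L := by omega
  have hb := line_bond_eq_b0_of_onAxis hj c r hon
  have e : P.L - (P.L - 1 - (r c.dir : ℕ)) - 1 = r c.dir := by omega
  constructor
  · rw [rowProd_eq_split U _ c.dir ht, hb, e]
  · rw [← hb, rowProd_update_line hj c r U g ht, e]

/-- **THE SEGMENT `c` ITSELF** (`x = emb c₋`, on the axis, `b₀(c)` at step `(L−1)/2`): `U(c) = U([emb c₋, b₀₋])·U(b₀(c))·U([b₀₊, emb c₊])`, and the
replaced form. [cite: Balaban1987RG1, p.267] -/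
theorem rowProd_axis_split [DecidableEq (PBond P j)] (hj : j + 1 ≤ P.m + P.K) (U : GaugeField P j G) (c : PBond P (j + 1)) (g : G) :
    rowProd U (emb c.src) c.dir P.L =
        rowProd U (emb c.src) c.dir ((P.L - 1) / 2) * U (b0 c) * rowProd U (shiftN (emb c.src) c.dir ((P.L - 1) / 2 + 1)) c.dir ((P.L - 1) / 2) ∧
      rowProd (Function.update U (b0 c) g) (emb c.src) c.dir P.L =
        rowProd U (emb c.src) c.dir ((P.L - 1) / 2) * g * rowProd U (shiftN (emb c.src) c.dir ((P.L - 1) / 2 + 1)) c.dir ((P.L - 1) / 2) := by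
  have hL := P.hL.2
  obtain ⟨k, hk⟩ := P.hL.1
  have h := rowProd_line_split_of_onAxis hj U c (fun _ => ⟨(P.L - 1) / 2, half_lt P⟩) (fun _ _ => rfl) g
  rw [← emb_eq_blockSite] at h
  have e : P.L - 1 - (P.L - 1) / 2 = (P.L - 1) / 2 := by omega
  simp only [e] at h
  exact h

end B12B0LoopGeometry267

end Literature.MathematicalPhysics.QuantumFieldTheory.Balaban1983to89
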